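import Literature.NumberTheory.LFunctions.MoebiusLogSqHarmonicSum
import HarnessLib

/-!
# Route `PrimeLevelFamEdge`, crux K_A `MomentsBeyondDiagonal` (stmt-Parity-20007), line «petersson_layers» v4, stub `stub_diag`:
# **the constant of the second logarithmic Riesz mean of `μ(n)/n`, with the de la Vallée-Poussin rate**
# `R₂(y) = Σ_{n ≤ y} μ(n) log²(y/n)/n = 2 log y + ρ + O(exp(−c√log y))`

First brick (L1 of the plan in `Cruxes/MomentsBeyondDiagonal/Lines/petersson_layers_stub_diag_g12_R02_R22.md`) of the ONE new
analytic input of the order-`(2,2)` remainder estimate (R₂₂) of `stub_diag`: the asymptotic with rate of the `P₂`-DECORATED Selberg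
coefficients `Σ_{k ≤ y} a_n(k)P₂(k) = c_n + O(D(n)(1+log y)⁻¹²)` (their partial sums do NOT tend to zero, so the both-sided monomial
`P₂(k₁)P₂(k₂)·r₀₀` of the `(2,2)` remainder weight is handled by subtracting `c_n·δ₁`). That asymptotic is reached by two hyperbola
steps from `Σ_{d ≤ y} μ(d)P₂(d)/d = −log y + c + O(…)`, which in turn is `−½R₂(y) +` (Mertens sums); hence the constant of `R₂`
is needed WITH a rate — the tree's `…MoebiusLogSum.exists_abs_moebiusLogSqSum_sub_two_mul_log_le` gives `R₂(y) − 2 log y = O(1)` only.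

* `abs_integral_Ioi_log_mul_moebiusHarmonic_div_le` — the tail `|∫_y^∞ log t · m(t) dt/t| ≤ C e^{−(c₀/4)√log y}` (`y ≥ 2`);
* `moebiusLogSqSum_sub_two_mul_log_eq` — `R₂(y) − 2 log y = −2∫_1^y m log t dt/t − 2 log y ∫_y^∞ m dt/t` (`y ≥ 1`;
  re-derived, the tree's copy is private);
* `exists_abs_moebiusLogSqSum_sub_sub_const_le` — **`∃ ρ, c > 0, C: |R₂(y) − 2 log y − ρ| ≤ C exp(−c√log y)` for all `y ≥ 2`**,
  `ρ = −2∫_1^∞ m(t) log t dt/t` (`m(t) = Σ_{n ≤ t} μ(n)/n`, `∫_1^∞ m dt/t = 1`).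

Def-free; theorems only; classical (Hardy–Wright §22.14 prove the `O(1)` form elementarily; the rate is read off the tree's
de la Vallée-Poussin bound `m(t) ≪ e^{−c√log t}`, Montgomery–Vaughan Thm. 6.9 / §8.1). Helper `--supports stmt-Parity-20007`;
closes nothing; K_A, K_B and the Parity summit are NOT proved; nothing about Landau–Siegel zeros.

## References
* G. H. Hardy, E. M. Wright, *An Introduction to the Theory of Numbers*, 6th ed., OUP 2008, §22.14 (22.14.10)–(22.14.12).
  [cite: HardyWright2008, §22.14 (22.14.10)–(22.14.12) — derivation (constant and rate)]
* H. L. Montgomery, R. C. Vaughan, *Multiplicative Number Theory I*, CUP 2007, Thm. 6.9 and §8.1 (8.6)–(8.8).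
  [cite: MontgomeryVaughan2007, §8.1 — derivation]
-/

noncomputable section

open Real MeasureTheory Set Finset

namespace Summit.Parity.GeneralizedHardyLittlewood.Theorems.MomentsBeyondDiagonal.DiagCorner

open Literature.NumberTheory.Sieve.GreenTao2008
open Literature.NumberTheory.LFunctions.MoebiusLogSum
open Literature.NumberTheory.LFunctions (MoebiusSum.integrableOn_exp_neg_mul_sqrt_log_div)

/-- **Tail of `∫ log t · m(t) dt/t`.** Under `|m(x)| ≤ C₀e^{−c₀√log x}` (`x ≥ 2`): for `y ≥ 2`,
`∫_{(y,∞)} |log t · m(t)/t| dt ≤ C₀(24/(c₀/2)⁴+1)·K₄·e^{−(c₀/4)√log y}`, `K₄ = ∫_1^∞ e^{−(c₀/4)√log t}dt/t`.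
[cite: MontgomeryVaughan2007, Thm. 6.9 — derivation] -/
theorem integral_Ioi_abs_log_mul_moebiusHarmonic_div_le {c₀ C₀ : ℝ} (hc₀ : 0 < c₀) (hC₀ : 0 ≤ C₀)
    (hmb : ∀ x : ℝ, 2 ≤ x → |moebiusHarmonic x| ≤ C₀ * Real.exp (-(c₀ * Real.sqrt (Real.log x))))
    {y : ℝ} (hy : 2 ≤ y) :
    ∫ t in Set.Ioi y, |Real.log t * (moebiusHarmonic t / t)| ≤
      C₀ * (24 / (c₀ / 2) ^ 4 + 1) * (∫ t in Set.Ioi 1, Real.exp (-(c₀ / 4 * Real.sqrt (Real.log t))) / t) *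
        Real.exp (-(c₀ / 4 * Real.sqrt (Real.log y))) := by
  have hy1 : 1 < y := by linarith
  set L : ℝ := 24 / (c₀ / 2) ^ 4 + 1 with hL
  have hL0 : 0 ≤ L := by positivity
  set K := ∫ t in Set.Ioi 1, Real.exp (-(c₀ / 4 * Real.sqrt (Real.log t))) / t with hK
  set Ey := Real.exp (-(c₀ / 4 * Real.sqrt (Real.log y))) with hEy
  have hsub : Set.Ioi y ⊆ Set.Ioi 1 := Set.Ioi_subset_Ioi hy1.le
  have hdom : IntegrableOn (fun t : ℝ ↦ Real.exp (-(c₀ / 4 * Real.sqrt (Real.log t))) / t) (Set.Ioi y) :=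
    (MoebiusSum.integrableOn_exp_neg_mul_sqrt_log_div (by positivity : 0 < c₀ / 4)).mono_set hsub
  -- pointwise: `|log t · m(t)/t| ≤ C₀ L · Ey · e^{-(c₀/4)√log t}/t` for `t > y`
  have hpt : ∀ t ∈ Set.Ioi y, |Real.log t * (moebiusHarmonic t / t)| ≤
      C₀ * L * Ey * (Real.exp (-(c₀ / 4 * Real.sqrt (Real.log t))) / t) := by
    intro t ht
    have hty : y < t := ht
    have ht2 : 2 ≤ t := by linarith
    have ht0 : 0 < t := by linarith
    have ht1 : 1 ≤ t := by linarith
    have hlog0 : 0 ≤ Real.log t := Real.log_nonneg ht1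
    have hm := hmb t ht2
    have hsplit : Real.exp (-(c₀ * Real.sqrt (Real.log t))) =
        Real.exp (-(c₀ / 2 * Real.sqrt (Real.log t))) *
          (Real.exp (-(c₀ / 4 * Real.sqrt (Real.log t))) * Real.exp (-(c₀ / 4 * Real.sqrt (Real.log t)))) := by
      rw [← Real.exp_add, ← Real.exp_add]; ring_nf
    have hKx := log_mul_exp_neg_mul_sqrt_le (half_pos hc₀) ht1
    -- monotonicity `e^{-(c₀/4)√log t} ≤ e^{-(c₀/4)√log y}`
    have hmono : Real.exp (-(c₀ / 4 * Real.sqrt (Real.log t))) ≤ Ey := by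
      rw [hEy]
      apply Real.exp_le_exp.2
      have : Real.sqrt (Real.log y) ≤ Real.sqrt (Real.log t) :=
        Real.sqrt_le_sqrt (Real.log_le_log (by linarith) hty.le)
      have hc4 : 0 ≤ c₀ / 4 := by positivity
      nlinarith
    rw [abs_mul, abs_of_nonneg hlog0, abs_div, abs_of_pos ht0]
    calc Real.log t * (|moebiusHarmonic t| / t)
        ≤ Real.log t * (C₀ * Real.exp (-(c₀ * Real.sqrt (Real.log t))) / t) :=
          mul_le_mul_of_nonneg_left (div_le_div_of_nonneg_right hm ht0.le) hlog0
      _ = C₀ * (Real.log t * Real.exp (-(c₀ / 2 * Real.sqrt (Real.log t)))) *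
            Real.exp (-(c₀ / 4 * Real.sqrt (Real.log t))) *
            (Real.exp (-(c₀ / 4 * Real.sqrt (Real.log t))) / t) := by
          rw [hsplit]; ring
      _ ≤ C₀ * L * Ey * (Real.exp (-(c₀ / 4 * Real.sqrt (Real.log t))) / t) := by
          have h1 : C₀ * (Real.log t * Real.exp (-(c₀ / 2 * Real.sqrt (Real.log t)))) ≤ C₀ * L :=
            mul_le_mul_of_nonneg_left hKx hC₀
          have h2 : 0 ≤ Real.exp (-(c₀ / 4 * Real.sqrt (Real.log t))) / t := by positivity
          have h3 : 0 ≤ Real.exp (-(c₀ / 4 * Real.sqrt (Real.log t))) := (Real.exp_pos _).le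
          have h4 : 0 ≤ C₀ * (Real.log t * Real.exp (-(c₀ / 2 * Real.sqrt (Real.log t)))) := by positivity
          gcongr
  calc ∫ t in Set.Ioi y, |Real.log t * (moebiusHarmonic t / t)|
      ≤ ∫ t in Set.Ioi y, C₀ * L * Ey * (Real.exp (-(c₀ / 4 * Real.sqrt (Real.log t))) / t) := by
        refine setIntegral_mono_on ?_ (hdom.const_mul _) measurableSet_Ioi hpt
        exact ((integrableOn_log_mul_moebiusHarmonic_div).mono_set hsub).abs
    _ = C₀ * L * Ey * ∫ t in Set.Ioi y, Real.exp (-(c₀ / 4 * Real.sqrt (Real.log t))) / t := integral_const_mul _ _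
    _ ≤ C₀ * L * Ey * K := by
        apply mul_le_mul_of_nonneg_left _ (by positivity)
        exact setIntegral_mono_set (MoebiusSum.integrableOn_exp_neg_mul_sqrt_log_div (by positivity : 0 < c₀ / 4))
          (ae_restrict_of_forall_mem measurableSet_Ioi fun t ht ↦
            div_nonneg (Real.exp_pos _).le (zero_le_one.trans (le_of_lt ht)))
          (ae_of_all _ hsub)
    _ = C₀ * L * K * Ey := by ring

/-- **`R₂(y) − 2 log y = −2∫_{(1,y]} m(t) log t dt/t − 2 log y·∫_{(y,∞)} m(t) dt/t`** for `y ≥ 1` (`∫_1^∞ m dt/t = 1`).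
[cite: HardyWright2008, §22.14 (22.14.10)–(22.14.12) — derivation] -/
theorem moebiusLogSqSum_sub_two_mul_log_eq {y : ℝ} (hy : 1 ≤ y) :
    moebiusLogSqSum y - 2 * Real.log y =
      -(2 * ∫ t in Set.Ioc 1 y, Real.log t * (moebiusHarmonic t / t)) -
        2 * Real.log y * ∫ t in Set.Ioi y, moebiusHarmonic t / t := by
  obtain ⟨c₀, hc₀, C₀, hC₀, hmb⟩ := exists_abs_moebiusHarmonic_le
  have hLint := integrableOn_moebiusHarmonic_div hc₀ hC₀ hmb
  have hJint := integrableOn_log_mul_moebiusHarmonic_div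
  have hone := integral_moebiusHarmonic_div_eq_one
  have hunion : Set.Ioc 1 y ∪ Set.Ioi y = Set.Ioi 1 := Set.Ioc_union_Ioi_eq_Ioi hy
  have hdisj : Disjoint (Set.Ioc 1 y) (Set.Ioi y) := fun s hs1 hs2 t ht ↦
    absurd (lt_of_lt_of_le (Set.mem_Ioi.mp (hs2 ht)) (Set.mem_Ioc.mp (hs1 ht)).2) (lt_irrefl _)
  have hsum := setIntegral_union hdisj measurableSet_Ioi (hLint.mono_set Set.Ioc_subset_Ioi_self)
    (hLint.mono_set (Set.Ioi_subset_Ioi hy))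
  rw [hunion, hone] at hsum
  have hlin : ∫ t in Set.Ioc 1 y, (Real.log y - Real.log t) * (moebiusHarmonic t / t) =
      Real.log y * (∫ t in Set.Ioc 1 y, moebiusHarmonic t / t) -
        ∫ t in Set.Ioc 1 y, Real.log t * (moebiusHarmonic t / t) := by
    rw [← integral_const_mul, ← integral_sub ((hLint.mono_set Set.Ioc_subset_Ioi_self).const_mul _)
      (hJint.mono_set Set.Ioc_subset_Ioi_self)]
    refine setIntegral_congr_fun measurableSet_Ioc fun t _ ↦ ?_
    ring
  rw [moebiusLogSqSum_eq_integral hy, hlin]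
  have : ∫ t in Set.Ioc 1 y, moebiusHarmonic t / t = 1 - ∫ t in Set.Ioi y, moebiusHarmonic t / t := by
    linarith
  rw [this]
  ring

/-- **The constant of `R₂` with the de la Vallée-Poussin rate**: there are `ρ`, `c > 0`, `C ≥ 0` with
`|Σ_{n ≤ y} μ(n) log²(y/n)/n − 2 log y − ρ| ≤ C·exp(−c√log y)` for every `y ≥ 2` (`ρ = −2∫_1^∞ m(t) log t dt/t`).
[cite: HardyWright2008, §22.14 (22.14.10)–(22.14.12) — derivation (constant and rate)] -/
theorem exists_abs_moebiusLogSqSum_sub_sub_const_le :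
    ∃ ρ c : ℝ, 0 < c ∧ ∃ C : ℝ, 0 ≤ C ∧ ∀ y : ℝ, 2 ≤ y →
      |moebiusLogSqSum y - 2 * Real.log y - ρ| ≤ C * Real.exp (-(c * Real.sqrt (Real.log y))) := by
  obtain ⟨c₀, hc₀, C₀, hC₀, hmb⟩ := exists_abs_moebiusHarmonic_le
  have hJint := integrableOn_log_mul_moebiusHarmonic_div
  have hLint := integrableOn_moebiusHarmonic_div hc₀ hC₀ hmb
  -- constants
  set L : ℝ := 24 / (c₀ / 2) ^ 4 + 1 with hL
  have hL0 : 0 ≤ L := by positivity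
  set L' : ℝ := 24 / (c₀ / 4) ^ 4 + 1 with hL'
  have hL'0 : 0 ≤ L' := by positivity
  set K₂ : ℝ := ∫ t in Set.Ioi 1, Real.exp (-(c₀ / 2 * Real.sqrt (Real.log t))) / t with hK₂
  have hK₂0 : 0 ≤ K₂ := setIntegral_nonneg measurableSet_Ioi fun t ht ↦
    div_nonneg (Real.exp_pos _).le (zero_le_one.trans ht.le)
  set K₄ : ℝ := ∫ t in Set.Ioi 1, Real.exp (-(c₀ / 4 * Real.sqrt (Real.log t))) / t with hK₄
  have hK₄0 : 0 ≤ K₄ := setIntegral_nonneg measurableSet_Ioi fun t ht ↦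
    div_nonneg (Real.exp_pos _).le (zero_le_one.trans ht.le)
  refine ⟨-(2 * ∫ t in Set.Ioi 1, Real.log t * (moebiusHarmonic t / t)), c₀ / 4, by positivity,
    2 * (C₀ * L * K₄) + 2 * L' * (C₀ * K₂), by positivity, fun y hy ↦ ?_⟩
  have hy1 : 1 ≤ y := by linarith
  have hy0 : 0 < y := by linarith
  have hlogy : 0 ≤ Real.log y := Real.log_nonneg hy1
  set Ey := Real.exp (-(c₀ / 4 * Real.sqrt (Real.log y))) with hEy
  have hEy0 : 0 < Ey := Real.exp_pos _
  rw [moebiusLogSqSum_sub_two_mul_log_eq hy1]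
  -- `∫_{(1,∞)} = ∫_{(1,y]} + ∫_{(y,∞)}` for `log t · m/t`
  have hunion : Set.Ioc 1 y ∪ Set.Ioi y = Set.Ioi 1 := Set.Ioc_union_Ioi_eq_Ioi hy1
  have hdisj : Disjoint (Set.Ioc 1 y) (Set.Ioi y) := fun s hs1 hs2 t ht ↦
    absurd (lt_of_lt_of_le (Set.mem_Ioi.mp (hs2 ht)) (Set.mem_Ioc.mp (hs1 ht)).2) (lt_irrefl _)
  have hsum := setIntegral_union hdisj measurableSet_Ioi (hJint.mono_set Set.Ioc_subset_Ioi_self)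
    (hJint.mono_set (Set.Ioi_subset_Ioi hy1))
  rw [hunion] at hsum
  -- the two tails
  have hA : |∫ t in Set.Ioi y, Real.log t * (moebiusHarmonic t / t)| ≤ C₀ * L * K₄ * Ey :=
    (abs_integral_le_integral_abs).trans (integral_Ioi_abs_log_mul_moebiusHarmonic_div_le hc₀ hC₀ hmb hy)
  have hB : |∫ t in Set.Ioi y, moebiusHarmonic t / t| ≤
      C₀ * K₂ * Real.exp (-(c₀ / 2 * Real.sqrt (Real.log y))) :=
    (abs_integral_le_integral_abs).trans (integral_Ioi_abs_moebiusHarmonic_div_le hc₀ hC₀ hmb hy)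
  -- `log y · e^{-(c₀/2)√log y} ≤ L' · Ey`
  have hsplit : Real.exp (-(c₀ / 2 * Real.sqrt (Real.log y))) =
      Real.exp (-(c₀ / 4 * Real.sqrt (Real.log y))) * Ey := by
    rw [hEy, ← Real.exp_add]; ring_nf
  have hK' := log_mul_exp_neg_mul_sqrt_le (by positivity : 0 < c₀ / 4) hy1
  have hB' : |2 * Real.log y * ∫ t in Set.Ioi y, moebiusHarmonic t / t| ≤ 2 * L' * (C₀ * K₂) * Ey := by
    rw [abs_mul, abs_of_nonneg (by positivity : (0 : ℝ) ≤ 2 * Real.log y)]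
    calc 2 * Real.log y * |∫ t in Set.Ioi y, moebiusHarmonic t / t|
        ≤ 2 * Real.log y * (C₀ * K₂ * Real.exp (-(c₀ / 2 * Real.sqrt (Real.log y)))) :=
          mul_le_mul_of_nonneg_left hB (by positivity)
      _ = 2 * (Real.log y * Real.exp (-(c₀ / 4 * Real.sqrt (Real.log y)))) * (C₀ * K₂) * Ey := by
          rw [hsplit]; ring
      _ ≤ 2 * L' * (C₀ * K₂) * Ey := by
          have : 0 ≤ C₀ * K₂ := by positivity
          gcongr
  -- assemble
  have heq : -(2 * ∫ t in Set.Ioc 1 y, Real.log t * (moebiusHarmonic t / t)) -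
        2 * Real.log y * (∫ t in Set.Ioi y, moebiusHarmonic t / t) -
        -(2 * ∫ t in Set.Ioi 1, Real.log t * (moebiusHarmonic t / t)) =
      2 * (∫ t in Set.Ioi y, Real.log t * (moebiusHarmonic t / t)) -
        2 * Real.log y * ∫ t in Set.Ioi y, moebiusHarmonic t / t := by
    rw [hsum]; ring
  rw [heq]
  calc |2 * (∫ t in Set.Ioi y, Real.log t * (moebiusHarmonic t / t)) -
        2 * Real.log y * ∫ t in Set.Ioi y, moebiusHarmonic t / t|
      ≤ |2 * (∫ t in Set.Ioi y, Real.log t * (moebiusHarmonic t / t))| +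
          |2 * Real.log y * ∫ t in Set.Ioi y, moebiusHarmonic t / t| := abs_sub _ _
    _ ≤ 2 * (C₀ * L * K₄ * Ey) + 2 * L' * (C₀ * K₂) * Ey := by
        refine add_le_add ?_ hB'
        rw [abs_mul, abs_of_pos (by norm_num : (0 : ℝ) < 2)]
        exact mul_le_mul_of_nonneg_left hA (by norm_num)
    _ = (2 * (C₀ * L * K₄) + 2 * L' * (C₀ * K₂)) * Ey := by ring

end Summit.Parity.GeneralizedHardyLittlewood.Theorems.MomentsBeyondDiagonal.DiagCorner

end
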